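import Mathlib
import Summits.Ventures.PercRepro2.CoinChainXAGateBridge
import Summits.Ventures.PercRepro2.CoinChainXAJjGate
import Summits.Ventures.PercRepro2.CoinChainXAMGateChain
import Summits.Ventures.PercRepro2.CoinChainXAGMFact
import Summits.Ventures.PercRepro2.CoinChainXAGR1Fact
import Summits.Ventures.PercRepro2.CoinChainXAHGFact
import Summits.Ventures.PercRepro2.CoinChainXAJGFact
import Summits.Ventures.PercRepro2.CoinChainXAJGateParts
import Summits.Ventures.PercRepro2.CoinChainXACellFactsK
import Summits.Ventures.PercRepro2.CoinChainXACellFactsU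
import Summits.Ventures.PercRepro2.CoinChainXACellFactsA
import Summits.Ventures.PercRepro2.CoinChainXAJGateGeneral

/-!
# The `j` gate of the (j, j′) pair is a theorem of the chain
(blind cell PercRepro2, night-2 g32; proofs/NIGHT2-DARC.md §73.7)

`chain_XA'_j_gate`: for `ent = {m}`, ANY `ent' ∋ j, j'`, the entry markers and the gate `d' = d·1[j ∈ W]`, the cleared
(XA′) holds under the chain's standing hypotheses: the general-gate bridge, the gate sums (`j_gate_sum*`), the
Ahlswede–Daykin facts of the chain rewritten into the marker cells, and the cell inequality `cg_j_general`.
-/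

namespace Summit.Ventures.PercRepro2.Coin

open Classical

section JGateMain

variable {V : Type*} [DecidableEq V] {R : Type*} [Field R] [LinearOrder R] [IsStrictOrderedRing R]

set_option maxHeartbeats 4000000 in
/-- **THE `j` GATE IS A THEOREM OF THE CHAIN**. -/
theorem chain_XA'_j_gate (U : Finset V) (m j j' : V) (ent' : Finset V) (ν c d : Finset V → R)
    (hj : j ∈ ent') (hj' : j' ∈ ent')
    (hν0 : ∀ W, 0 ≤ ν W) (hν : ∀ s ⊆ U, ∀ t ⊆ U, ν s * ν t ≤ ν (s ∩ t) * ν (s ∪ t))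
    (hc0 : ∀ W, 0 ≤ c W) (hd0 : ∀ W, 0 ≤ d W) (hdc : ∀ W, d W ≤ c W)
    (hcd : ∀ s t, c s * d t ≤ c (s ∩ t) * d (s ∪ t))
    (hratio : ∀ s t, s ⊆ t → d s * c t ≤ c s * d t)
    (hdd : ∀ s t, d s * d t ≤ d (s ∩ t) * d (s ∪ t))
    (x y : Finset V → R) (hx : ∀ W, x W = if j ∈ W then 1 else 0) (hy : ∀ W, y W = if j' ∈ W then 1 else 0) :
    (((∑ W ∈ U.powerset, ν W * chainMix {m} ent' 0 c d W) * (∑ W ∈ U.powerset, ν W * chainMix {m} ent' 1 c d W * x W) - (∑ W ∈ U.powerset, ν W * chainMix {m} ent' 0 c d W * x W) * (∑ W ∈ U.powerset, ν W * chainMix {m} ent' 1 c d W)) *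
          ((∑ W ∈ U.powerset, ν W * chainMix {m} ent' 0 c d W) * (∑ W ∈ U.powerset, ν W * chainMix {m} ent' 0 c (fun W => if j ∈ W then d W else 0) W * y W) - (∑ W ∈ U.powerset, ν W * chainMix {m} ent' 0 c d W * y W) * (∑ W ∈ U.powerset, ν W * chainMix {m} ent' 0 c (fun W => if j ∈ W then d W else 0) W))
        + ((∑ W ∈ U.powerset, ν W * chainMix {m} ent' 0 c d W) * (∑ W ∈ U.powerset, ν W * chainMix {m} ent' 1 c d W * y W) - (∑ W ∈ U.powerset, ν W * chainMix {m} ent' 0 c d W * y W) * (∑ W ∈ U.powerset, ν W * chainMix {m} ent' 1 c d W)) *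
          ((∑ W ∈ U.powerset, ν W * chainMix {m} ent' 0 c d W) * (∑ W ∈ U.powerset, ν W * chainMix {m} ent' 0 c (fun W => if j ∈ W then d W else 0) W * x W) - (∑ W ∈ U.powerset, ν W * chainMix {m} ent' 0 c d W * x W) * (∑ W ∈ U.powerset, ν W * chainMix {m} ent' 0 c (fun W => if j ∈ W then d W else 0) W))) ≤
        (∑ W ∈ U.powerset, ν W * chainMix {m} ent' 0 c d W) * ((∑ W ∈ U.powerset, ν W * chainMix {m} ent' 0 c d W) * (∑ W ∈ U.powerset, ν W * chainMix {m} ent' 0 c d W) * (∑ W ∈ U.powerset, ν W * chainMix {m} ent' 1 c (fun W => if j ∈ W then d W else 0) W * (x W * y W))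
          - (∑ W ∈ U.powerset, ν W * chainMix {m} ent' 0 c d W) * (∑ W ∈ U.powerset, ν W * chainMix {m} ent' 0 c d W * y W) * (∑ W ∈ U.powerset, ν W * chainMix {m} ent' 1 c (fun W => if j ∈ W then d W else 0) W * x W)
          - (∑ W ∈ U.powerset, ν W * chainMix {m} ent' 0 c d W) * (∑ W ∈ U.powerset, ν W * chainMix {m} ent' 0 c d W * x W) * (∑ W ∈ U.powerset, ν W * chainMix {m} ent' 1 c (fun W => if j ∈ W then d W else 0) W * y W)
          + (∑ W ∈ U.powerset, ν W * chainMix {m} ent' 0 c d W * x W) * (∑ W ∈ U.powerset, ν W * chainMix {m} ent' 0 c d W * y W) * (∑ W ∈ U.powerset, ν W * chainMix {m} ent' 1 c (fun W => if j ∈ W then d W else 0) W)) := by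
  refine chain_XA'_gate_of_parts U m j j' ent' ν c d (fun W => if j ∈ W then d W else 0) hj hj' x y hx hy ?_
  have eD0 := j_gate_sum0 U j ν d (fun W => (¬ ∃ r ∈ ({m} : Finset V), r ∈ W) ∧ ∃ r ∈ ent', r ∈ W) x hx
  have eDx := j_gate_sumx U j ν d (fun W => (¬ ∃ r ∈ ({m} : Finset V), r ∈ W) ∧ ∃ r ∈ ent', r ∈ W) x hx
  have eDy := j_gate_sumy U j ν d (fun W => (¬ ∃ r ∈ ({m} : Finset V), r ∈ W) ∧ ∃ r ∈ ent', r ∈ W) x y hx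
  have eDxy := j_gate_sumxy U j ν d (fun W => (¬ ∃ r ∈ ({m} : Finset V), r ∈ W) ∧ ∃ r ∈ ent', r ∈ W) x y hx
  have eM0 := j_gate_sum0 U j ν d (fun W => ∃ r ∈ ({m} : Finset V), r ∈ W) x hx
  have eMx := j_gate_sumx U j ν d (fun W => ∃ r ∈ ({m} : Finset V), r ∈ W) x hx
  have eMy := j_gate_sumy U j ν d (fun W => ∃ r ∈ ({m} : Finset V), r ∈ W) x y hx
  have eMxy := j_gate_sumxy U j ν d (fun W => ∃ r ∈ ({m} : Finset V), r ∈ W) x y hx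
  rw [eD0, eDx, eDy, eDxy, eM0, eMx, eMy, eMxy]
  have hx0 : ∀ W, 0 ≤ x W := fun W => by rw [hx W]; split_ifs <;> norm_num
  have hy0 : ∀ W, 0 ≤ y W := fun W => by rw [hy W]; split_ifs <;> norm_num
  have hx1 : ∀ W, x W ≤ 1 := fun W => by rw [hx W]; split_ifs <;> norm_num
  have hy1 : ∀ W, y W ≤ 1 := fun W => by rw [hy W]; split_ifs <;> norm_num
  have hxm : ∀ s t, x s ≤ x (s ∪ t) := fun s t => by
    rw [hx s, hx (s ∪ t)]
    by_cases h : j ∈ s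
    · rw [if_pos h, if_pos (Finset.mem_union_left t h)]
    · rw [if_neg h]; split_ifs <;> norm_num
  have hym : ∀ s t, y s ≤ y (s ∪ t) := fun s t => by
    rw [hy s, hy (s ∪ t)]
    by_cases h : j' ∈ s
    · rw [if_pos h, if_pos (Finset.mem_union_left t h)]
    · rw [if_neg h]; split_ifs <;> norm_num
  have hxI : ∀ W, (¬ ∃ r ∈ ({m} : Finset V) ∪ ent', r ∈ W) → x W = 0 := fun W hW => by
    rw [hx W]; exact if_neg (fun h => hW ⟨j, Finset.mem_union.2 (Or.inr hj), h⟩)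
  have hyI : ∀ W, (¬ ∃ r ∈ ({m} : Finset V) ∪ ent', r ∈ W) → y W = 0 := fun W hW => by
    rw [hy W]; exact if_neg (fun h => hW ⟨j', Finset.mem_union.2 (Or.inr hj'), h⟩)
  -- the part sums
  set a := (∑ W ∈ U.powerset.filter (fun W => ¬ ∃ r ∈ ({m} : Finset V) ∪ ent', r ∈ W), ν W * c W) with ha_def
  set δ := (∑ W ∈ U.powerset.filter (fun W => (¬ ∃ r ∈ ({m} : Finset V), r ∈ W) ∧ ∃ r ∈ ent', r ∈ W), ν W * (c W - d W)) with hδ_def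
  set u := (∑ W ∈ U.powerset.filter (fun W => (¬ ∃ r ∈ ({m} : Finset V), r ∈ W) ∧ ∃ r ∈ ent', r ∈ W), ν W * d W) with hu_def
  set t := (∑ W ∈ U.powerset.filter (fun W => ∃ r ∈ ({m} : Finset V), r ∈ W), ν W * d W) with ht_def
  set XJ := (∑ W ∈ U.powerset.filter (fun W => (¬ ∃ r ∈ ({m} : Finset V), r ∈ W) ∧ ∃ r ∈ ent', r ∈ W), ν W * (c W - d W) * x W) with hXJ_def
  set XU := (∑ W ∈ U.powerset.filter (fun W => (¬ ∃ r ∈ ({m} : Finset V), r ∈ W) ∧ ∃ r ∈ ent', r ∈ W), ν W * d W * x W) with hXU_def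
  set XM := (∑ W ∈ U.powerset.filter (fun W => ∃ r ∈ ({m} : Finset V), r ∈ W), ν W * d W * x W) with hXM_def
  set YJ := (∑ W ∈ U.powerset.filter (fun W => (¬ ∃ r ∈ ({m} : Finset V), r ∈ W) ∧ ∃ r ∈ ent', r ∈ W), ν W * (c W - d W) * y W) with hYJ_def
  set YU := (∑ W ∈ U.powerset.filter (fun W => (¬ ∃ r ∈ ({m} : Finset V), r ∈ W) ∧ ∃ r ∈ ent', r ∈ W), ν W * d W * y W) with hYU_def
  set YM := (∑ W ∈ U.powerset.filter (fun W => ∃ r ∈ ({m} : Finset V), r ∈ W), ν W * d W * y W) with hYM_def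
  set XYM := (∑ W ∈ U.powerset.filter (fun W => ∃ r ∈ ({m} : Finset V), r ∈ W), ν W * d W * (x W * y W)) with hXYM_def
  set XYU := (∑ W ∈ U.powerset.filter (fun W => (¬ ∃ r ∈ ({m} : Finset V), r ∈ W) ∧ ∃ r ∈ ent', r ∈ W), ν W * d W * (x W * y W)) with hXYU_def
  have hcd0 : ∀ W, 0 ≤ c W - d W := fun W => by linarith [hdc W]
  have ha : 0 ≤ a := Finset.sum_nonneg (fun W _ => mul_nonneg (hν0 W) (hc0 W))
  have hδ : 0 ≤ δ := Finset.sum_nonneg (fun W _ => mul_nonneg (hν0 W) (hcd0 W))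
  have hu : 0 ≤ u := Finset.sum_nonneg (fun W _ => mul_nonneg (hν0 W) (hd0 W))
  have ht : 0 ≤ t := Finset.sum_nonneg (fun W _ => mul_nonneg (hν0 W) (hd0 W))
  have hXJ : 0 ≤ XJ := Finset.sum_nonneg (fun W _ => mul_nonneg (mul_nonneg (hν0 W) (hcd0 W)) (hx0 W))
  have hXU : 0 ≤ XU := Finset.sum_nonneg (fun W _ => mul_nonneg (mul_nonneg (hν0 W) (hd0 W)) (hx0 W))
  have hXM : 0 ≤ XM := Finset.sum_nonneg (fun W _ => mul_nonneg (mul_nonneg (hν0 W) (hd0 W)) (hx0 W))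
  have hYJ : 0 ≤ YJ := Finset.sum_nonneg (fun W _ => mul_nonneg (mul_nonneg (hν0 W) (hcd0 W)) (hy0 W))
  have hYU : 0 ≤ YU := Finset.sum_nonneg (fun W _ => mul_nonneg (mul_nonneg (hν0 W) (hd0 W)) (hy0 W))
  have hYM : 0 ≤ YM := Finset.sum_nonneg (fun W _ => mul_nonneg (mul_nonneg (hν0 W) (hd0 W)) (hy0 W))
  have hXYM : 0 ≤ XYM := Finset.sum_nonneg (fun W _ => mul_nonneg (mul_nonneg (hν0 W) (hd0 W)) (mul_nonneg (hx0 W) (hy0 W)))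
  have hXYU : 0 ≤ XYU := Finset.sum_nonneg (fun W _ => mul_nonneg (mul_nonneg (hν0 W) (hd0 W)) (mul_nonneg (hx0 W) (hy0 W)))
  -- the ideal carries no marker
  have hIx : (∑ W ∈ U.powerset.filter (fun W => ¬ ∃ r ∈ ({m} : Finset V) ∪ ent', r ∈ W), ν W * c W * x W) = 0 :=
    cgate_sum_zero U _ _ (fun W hW => by rw [hxI W hW, mul_zero])
  have hIy : (∑ W ∈ U.powerset.filter (fun W => ¬ ∃ r ∈ ({m} : Finset V) ∪ ent', r ∈ W), ν W * c W * y W) = 0 :=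
    cgate_sum_zero U _ _ (fun W hW => by rw [hyI W hW, mul_zero])
  have hIx : (∑ W ∈ U.powerset.filter (fun W => ¬ ∃ r ∈ ({m} : Finset V) ∪ ent', r ∈ W), ν W * c W * x W) = 0 :=
    cgate_sum_zero U _ _ (fun W hW => by rw [hxI W hW, mul_zero])
  have hIy : (∑ W ∈ U.powerset.filter (fun W => ¬ ∃ r ∈ ({m} : Finset V) ∪ ent', r ∈ W), ν W * c W * y W) = 0 :=
    cgate_sum_zero U _ _ (fun W hW => by rw [hyI W hW, mul_zero])
  have eyx : ∑ W ∈ U.powerset.filter (fun W => ∃ r ∈ ({m} : Finset V), r ∈ W), ν W * d W * (y W * x W) = XYM :=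
    Finset.sum_congr rfl (fun W _ => by ring)
  have eyxD : ∑ W ∈ U.powerset.filter (fun W => (¬ ∃ r ∈ ({m} : Finset V), r ∈ W) ∧ ∃ r ∈ ent', r ∈ W), ν W * d W * (y W * x W) = XYU :=
    Finset.sum_congr rfl (fun W _ => by ring)
  have FBx := cg_fact_BB U {m} ent' ν d hν0 hν hd0 hdd x hx0 hxm
  have FBy := cg_fact_BB U {m} ent' ν d hν0 hν hd0 hdd y hy0 hym
  have FB2 := cg_fact_BB2 U {m} ent' ν d hν0 hν hd0 hdd y x hy0 hx0 hym hxm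
  have FB2' := cg_fact_BB2 U {m} ent' ν d hν0 hν hd0 hdd x y hx0 hy0 hxm hym
  rw [sum_entfree_split U {m} ent' (fun W => ν W * d W)] at FBx FBy FB2 FB2'
  rw [eyx] at FB2
  have hBI : (∑ W ∈ U.powerset.filter (fun W => ¬ ∃ r ∈ ({m} : Finset V) ∪ ent', r ∈ W), ν W * d W) ≤ a :=
    Finset.sum_le_sum (fun W _ => mul_le_mul_of_nonneg_left (hdc W) (hν0 W))
  have FDD2 := cg_fact_DD2 U {m} ent' ν c d hν0 hν hc0 hd0 hcd x y hx0 hy0 hxm hym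
  rw [sum_entfree_split U {m} ent' (fun W => ν W * c W), cg_split' U ν c d (fun W => (¬ ∃ r ∈ ({m} : Finset V), r ∈ W) ∧ ∃ r ∈ ent', r ∈ W), cg_split U ν c d (fun W => (¬ ∃ r ∈ ({m} : Finset V), r ∈ W) ∧ ∃ r ∈ ent', r ∈ W) y] at FDD2
  have FDD2' := cg_fact_DD2 U {m} ent' ν c d hν0 hν hc0 hd0 hcd y x hy0 hx0 hym hxm
  rw [sum_entfree_split U {m} ent' (fun W => ν W * c W), cg_split' U ν c d (fun W => (¬ ∃ r ∈ ({m} : Finset V), r ∈ W) ∧ ∃ r ∈ ent', r ∈ W), cg_split U ν c d (fun W => (¬ ∃ r ∈ ({m} : Finset V), r ∈ W) ∧ ∃ r ∈ ent', r ∈ W) x] at FDD2'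
  rw [eyxD] at FDD2'
  have FGM := cg_fact_GM U m ent' ν c d hν0 hν hc0 hd0 hdc hcd hdd x y hx0 hy0 hxm hym hxI hyI
  have FGMp := cg_fact_GM U m ent' ν c d hν0 hν hc0 hd0 hdc hcd hdd y x hy0 hx0 hym hxm hyI hxI
  rw [eyxD, eyx] at FGMp
  have FGR1 := cg_fact_GR1 U m ent' ν c d hν0 hν hc0 hd0 hdc hcd hdd x y hx0 hy0 hxm hym hxI hyI
  have FHG := cg_fact_HG U m ent' ν c d hν0 hν hc0 hd0 hdc hcd hdd x y hx0 hy0 hx1 hxm hym hxI hyI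
  have eDx1 : ∑ W ∈ U.powerset.filter (fun W => (¬ ∃ r ∈ ({m} : Finset V), r ∈ W) ∧ ∃ r ∈ ent', r ∈ W), ν W * d W * (1 - x W) = u - XU := by
    rw [hu_def, hXU_def, ← Finset.sum_sub_distrib]; exact Finset.sum_congr rfl (fun W _ => by ring)
  have eMx1 : ∑ W ∈ U.powerset.filter (fun W => ∃ r ∈ ({m} : Finset V), r ∈ W), ν W * d W * (1 - x W) = t - XM := by
    rw [ht_def, hXM_def, ← Finset.sum_sub_distrib]; exact Finset.sum_congr rfl (fun W _ => by ring)
  have eD0y : ∑ W ∈ U.powerset.filter (fun W => (¬ ∃ r ∈ ({m} : Finset V), r ∈ W) ∧ ∃ r ∈ ent', r ∈ W), ν W * d W * ((1 - x W) * y W) = YU - XYU := by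
    rw [hYU_def, hXYU_def, ← Finset.sum_sub_distrib]; exact Finset.sum_congr rfl (fun W _ => by ring)
  have eM0y : ∑ W ∈ U.powerset.filter (fun W => ∃ r ∈ ({m} : Finset V), r ∈ W), ν W * d W * ((1 - x W) * y W) = YM - XYM := by
    rw [hYM_def, hXYM_def, ← Finset.sum_sub_distrib]; exact Finset.sum_congr rfl (fun W _ => by ring)
  rw [eD0y, eM0y, eDx1, eMx1] at FHG
  have FHGp := cg_fact_HG U m ent' ν c d hν0 hν hc0 hd0 hdc hcd hdd y x hy0 hx0 hy1 hym hxm hyI hxI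
  rw [eyxD, eyx] at FHGp
  have eDy1 : ∑ W ∈ U.powerset.filter (fun W => (¬ ∃ r ∈ ({m} : Finset V), r ∈ W) ∧ ∃ r ∈ ent', r ∈ W), ν W * d W * (1 - y W) = u - YU := by
    rw [hu_def, hYU_def, ← Finset.sum_sub_distrib]; exact Finset.sum_congr rfl (fun W _ => by ring)
  have eMy1 : ∑ W ∈ U.powerset.filter (fun W => ∃ r ∈ ({m} : Finset V), r ∈ W), ν W * d W * (1 - y W) = t - YM := by
    rw [ht_def, hYM_def, ← Finset.sum_sub_distrib]; exact Finset.sum_congr rfl (fun W _ => by ring)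
  have eDx0 : ∑ W ∈ U.powerset.filter (fun W => (¬ ∃ r ∈ ({m} : Finset V), r ∈ W) ∧ ∃ r ∈ ent', r ∈ W), ν W * d W * ((1 - y W) * x W) = XU - XYU := by
    rw [hXU_def, hXYU_def, ← Finset.sum_sub_distrib]; exact Finset.sum_congr rfl (fun W _ => by ring)
  have eMx0 : ∑ W ∈ U.powerset.filter (fun W => ∃ r ∈ ({m} : Finset V), r ∈ W), ν W * d W * ((1 - y W) * x W) = XM - XYM := by
    rw [hXM_def, hXYM_def, ← Finset.sum_sub_distrib]; exact Finset.sum_congr rfl (fun W _ => by ring)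
  rw [eDx0, eMx0, eDy1, eMy1] at FHGp
  have FJG := cg_fact_JG U m ent' ν c d hν0 hν hc0 hd0 hdc hcd hratio x y hx0 hy0 hxm hym hxI hyI
  have FJGp := cg_fact_JG U m ent' ν c d hν0 hν hc0 hd0 hdc hcd hratio y x hy0 hx0 hym hxm hyI hxI
  rw [eyxD, eyx] at FJGp
  have FJUx := cg_fact_JU' U {m} ent' ν c d hν0 hν hc0 hd0 hdc hcd hratio x hx0 hxm
  have FJMx := cg_fact_JM' U {m} ent' ν c d hν0 hν hc0 hd0 hdc hcd hratio x hx0 hxm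
  have FJUy := cg_fact_JU' U {m} ent' ν c d hν0 hν hc0 hd0 hdc hcd hratio y hy0 hym
  have FJMy := cg_fact_JM' U {m} ent' ν c d hν0 hν hc0 hd0 hdc hcd hratio y hy0 hym
  rw [cg_entfree_piecewise U {m} ent' ν c d x, cg_entfree_piecewise' U {m} ent' ν c d, hIx, zero_add] at FJUx FJMx
  rw [cg_entfree_piecewise U {m} ent' ν c d y, cg_entfree_piecewise' U {m} ent' ν c d, hIy, zero_add] at FJUy FJMy
  have FMM := cg_fact_MM U ν d hν0 hν hd0 hdd m x y hx0 hy0 hxm hym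
  have FM2 := cg_fact_McM2 U {m} ent' ν c d hν0 hν hc0 hd0 hcd x y hx0 hy0 hxm hym
  have FM2' := cg_fact_McM2 U {m} ent' ν c d hν0 hν hc0 hd0 hcd y x hy0 hx0 hym hxm
  rw [sum_entfree_split U {m} ent' (fun W => ν W * c W), cg_split' U ν c d (fun W => (¬ ∃ r ∈ ({m} : Finset V), r ∈ W) ∧ ∃ r ∈ ent', r ∈ W), cg_split U ν c d (fun W => (¬ ∃ r ∈ ({m} : Finset V), r ∈ W) ∧ ∃ r ∈ ent', r ∈ W) y] at FM2
  rw [sum_entfree_split U {m} ent' (fun W => ν W * c W), cg_split' U ν c d (fun W => (¬ ∃ r ∈ ({m} : Finset V), r ∈ W) ∧ ∃ r ∈ ent', r ∈ W), cg_split U ν c d (fun W => (¬ ∃ r ∈ ({m} : Finset V), r ∈ W) ∧ ∃ r ∈ ent', r ∈ W) x] at FM2'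
  rw [eyx] at FM2'
  have FMx := cg_fact_McM U {m} ent' ν c d hν0 hν hc0 hd0 hcd x hx0 hxm
  have FMy := cg_fact_McM U {m} ent' ν c d hν0 hν hc0 hd0 hcd y hy0 hym
  rw [sum_entfree_split U {m} ent' (fun W => ν W * c W), cg_split' U ν c d (fun W => (¬ ∃ r ∈ ({m} : Finset V), r ∈ W) ∧ ∃ r ∈ ent', r ∈ W), cg_split U ν c d (fun W => (¬ ∃ r ∈ ({m} : Finset V), r ∈ W) ∧ ∃ r ∈ ent', r ∈ W) x] at FMx
  rw [sum_entfree_split U {m} ent' (fun W => ν W * c W), cg_split' U ν c d (fun W => (¬ ∃ r ∈ ({m} : Finset V), r ∈ W) ∧ ∃ r ∈ ent', r ∈ W), cg_split U ν c d (fun W => (¬ ∃ r ∈ ({m} : Finset V), r ∈ W) ∧ ∃ r ∈ ent', r ∈ W) y] at FMy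
  have FA1b := cg_cell_A1b U m j j' ent' ν c d hν0 hν hc0 hd0 hcd x y hx hy hxI hyI
  have FA1b2 := cg_cell_A1b2 U m j j' ent' ν c d hν0 hν hc0 hd0 hcd x y hx hy hxI hyI
  have FA2U1 := cg_cell_A2U1 U m j j' ent' ν c d hν0 hν hc0 hd0 hcd x y hx hy hxI hyI
  have FA2b := cg_cell_A2b U m j j' ent' ν c d hν0 hν hc0 hd0 hcd x y hx hy hxI hyI
  have FA2b1 := cg_cell_A2b1 U m j j' ent' ν c d hν0 hν hc0 hd0 hcd x y hx hy hxI hyI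
  have FIMy := cg_cell_IMy U m j j' ent' ν c d hν0 hν hc0 hd0 hdc hcd hratio x y hx hy hyI
  have FK1b := cg_cell_K1b U m j j' ent' ν c d hν0 hν hc0 hd0 hdc hcd hratio x y hx hy hxI hyI
  have FU12b := cg_cell_U12b U m j j' ent' ν c d hν0 hν hd0 hdc hdd x y hx hy hxI hyI
  have FU2b := cg_cell_U2b U m j j' ent' ν c d hν0 hν hd0 hdc hdd x y hx hy hxI hyI
  have FU2b1 := cg_cell_U2b1 U m j j' ent' ν c d hν0 hν hd0 hdc hdd x y hx hy hxI hyI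
  have hBBx : 0 ≤ XM * (a + u) - XU * t := by
    have h := mul_le_mul_of_nonneg_right hBI hXM
    linarith only [FBx, h]
  have hBBy : 0 ≤ YM * (a + u) - YU * t := by
    have h := mul_le_mul_of_nonneg_right hBI hYM
    linarith only [FBy, h]
  have hDD2 : 0 ≤ XYU * (a + δ + u) - (YJ + YU) * XU := by linear_combination FDD2
  have hDD2p : 0 ≤ XYU * (a + δ + u) - (XJ + XU) * YU := by linear_combination FDD2'
  have hGM : 0 ≤ (a + δ + u + t) * (XYU + XYM) - (XU + XM) * (YJ + YU + YM) := by linear_combination FGM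
  have hGMp : 0 ≤ (a + δ + u + t) * (XYU + XYM) - (YU + YM) * (XJ + XU + XM) := by linear_combination FGMp
  have hGR1 : 0 ≤ (a + u + t) * (XYU + XYM) - (XU + XM) * (YU + YM) := by linear_combination FGR1
  have hHG : 0 ≤ (a + (u - XU) + (t - XM)) * (XYU + XYM) - ((YU - XYU) + (YM - XYM)) * (XU + XM) := by linear_combination FHG
  have hHGp : 0 ≤ (a + (u - YU) + (t - YM)) * (XYU + XYM) - ((XU - XYU) + (XM - XYM)) * (YU + YM) := by linear_combination FHGp
  have hJG : 0 ≤ (a + δ) * (XYU + XYM) - YJ * (XU + XM) := by linear_combination FJG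
  have hJGp : 0 ≤ (a + δ) * (XYU + XYM) - XJ * (YU + YM) := by linear_combination FJGp
  have hJMx : 0 ≤ XM * (a + δ) - XJ * t := by linear_combination FJMx
  have hJMy : 0 ≤ YM * (a + δ) - YJ * t := by linear_combination FJMy
  have hJUx : 0 ≤ XU * (a + δ) - XJ * u := by linear_combination FJUx
  have hJUy : 0 ≤ YU * (a + δ) - YJ * u := by linear_combination FJUy
  have hLam : 0 ≤ XYM * t - XM * YM := by linear_combination FMM
  have hMcM2p : 0 ≤ XYM * (a + δ + u) - (XJ + XU) * YM := by linear_combination FM2'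
  have hsx : 0 ≤ XM * (a + δ + u) - (XJ + XU) * t := by linear_combination FMx
  have hsy : 0 ≤ YM * (a + δ + u) - (YJ + YU) * t := by linear_combination FMy
  -- the cells
  set K0 := (∑ W ∈ U.powerset.filter (fun W => (¬ ∃ r ∈ ({m} : Finset V), r ∈ W) ∧ ∃ r ∈ ent', r ∈ W), ν W * (c W - d W) * ((1 - x W) * (1 - y W))) with hK0_def
  set K1 := (∑ W ∈ U.powerset.filter (fun W => (¬ ∃ r ∈ ({m} : Finset V), r ∈ W) ∧ ∃ r ∈ ent', r ∈ W), ν W * (c W - d W) * (x W * (1 - y W))) with hK1_def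
  set K2 := (∑ W ∈ U.powerset.filter (fun W => (¬ ∃ r ∈ ({m} : Finset V), r ∈ W) ∧ ∃ r ∈ ent', r ∈ W), ν W * (c W - d W) * ((1 - x W) * y W)) with hK2_def
  set K12 := (∑ W ∈ U.powerset.filter (fun W => (¬ ∃ r ∈ ({m} : Finset V), r ∈ W) ∧ ∃ r ∈ ent', r ∈ W), ν W * (c W - d W) * (x W * y W)) with hK12_def
  set u0 := (∑ W ∈ U.powerset.filter (fun W => (¬ ∃ r ∈ ({m} : Finset V), r ∈ W) ∧ ∃ r ∈ ent', r ∈ W), ν W * d W * ((1 - x W) * (1 - y W))) with hu0_def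
  set U1 := (∑ W ∈ U.powerset.filter (fun W => (¬ ∃ r ∈ ({m} : Finset V), r ∈ W) ∧ ∃ r ∈ ent', r ∈ W), ν W * d W * (x W * (1 - y W))) with hU1_def
  set U2 := (∑ W ∈ U.powerset.filter (fun W => (¬ ∃ r ∈ ({m} : Finset V), r ∈ W) ∧ ∃ r ∈ ent', r ∈ W), ν W * d W * ((1 - x W) * y W)) with hU2_def
  set b := (∑ W ∈ U.powerset.filter (fun W => ∃ r ∈ ({m} : Finset V), r ∈ W), ν W * d W * ((1 - x W) * (1 - y W))) with hb_def
  set b1 := (∑ W ∈ U.powerset.filter (fun W => ∃ r ∈ ({m} : Finset V), r ∈ W), ν W * d W * (x W * (1 - y W))) with hb1_def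
  set b2 := (∑ W ∈ U.powerset.filter (fun W => ∃ r ∈ ({m} : Finset V), r ∈ W), ν W * d W * ((1 - x W) * y W)) with hb2_def
  have hK00 : 0 ≤ K0 := Finset.sum_nonneg (fun W _ => mul_nonneg (mul_nonneg (hν0 W) (hcd0 W)) (mul_nonneg (sub_nonneg.2 (hx1 W)) (sub_nonneg.2 (hy1 W))))
  have hK10 : 0 ≤ K1 := Finset.sum_nonneg (fun W _ => mul_nonneg (mul_nonneg (hν0 W) (hcd0 W)) (mul_nonneg (hx0 W) (sub_nonneg.2 (hy1 W))))
  have hK20 : 0 ≤ K2 := Finset.sum_nonneg (fun W _ => mul_nonneg (mul_nonneg (hν0 W) (hcd0 W)) (mul_nonneg (sub_nonneg.2 (hx1 W)) (hy0 W)))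
  have hK120 : 0 ≤ K12 := Finset.sum_nonneg (fun W _ => mul_nonneg (mul_nonneg (hν0 W) (hcd0 W)) (mul_nonneg (hx0 W) (hy0 W)))
  have hu00 : 0 ≤ u0 := Finset.sum_nonneg (fun W _ => mul_nonneg (mul_nonneg (hν0 W) (hd0 W)) (mul_nonneg (sub_nonneg.2 (hx1 W)) (sub_nonneg.2 (hy1 W))))
  have hU10 : 0 ≤ U1 := Finset.sum_nonneg (fun W _ => mul_nonneg (mul_nonneg (hν0 W) (hd0 W)) (mul_nonneg (hx0 W) (sub_nonneg.2 (hy1 W))))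
  have hU20 : 0 ≤ U2 := Finset.sum_nonneg (fun W _ => mul_nonneg (mul_nonneg (hν0 W) (hd0 W)) (mul_nonneg (sub_nonneg.2 (hx1 W)) (hy0 W)))
  have hb0 : 0 ≤ b := Finset.sum_nonneg (fun W _ => mul_nonneg (mul_nonneg (hν0 W) (hd0 W)) (mul_nonneg (sub_nonneg.2 (hx1 W)) (sub_nonneg.2 (hy1 W))))
  have hb10 : 0 ≤ b1 := Finset.sum_nonneg (fun W _ => mul_nonneg (mul_nonneg (hν0 W) (hd0 W)) (mul_nonneg (hx0 W) (sub_nonneg.2 (hy1 W))))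
  have hb20 : 0 ≤ b2 := Finset.sum_nonneg (fun W _ => mul_nonneg (mul_nonneg (hν0 W) (hd0 W)) (mul_nonneg (sub_nonneg.2 (hx1 W)) (hy0 W)))
  have eδ : δ = K0 + K1 + K2 + K12 := by
    rw [hδ_def, hK0_def, hK1_def, hK2_def, hK12_def, ← Finset.sum_add_distrib, ← Finset.sum_add_distrib, ← Finset.sum_add_distrib]
    exact Finset.sum_congr rfl (fun W _ => by ring)
  have eu : u = u0 + U1 + U2 + XYU := by
    rw [hu_def, hu0_def, hU1_def, hU2_def, hXYU_def, ← Finset.sum_add_distrib, ← Finset.sum_add_distrib, ← Finset.sum_add_distrib]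
    exact Finset.sum_congr rfl (fun W _ => by ring)
  have et : t = b + b1 + b2 + XYM := by
    rw [ht_def, hb_def, hb1_def, hb2_def, hXYM_def, ← Finset.sum_add_distrib, ← Finset.sum_add_distrib, ← Finset.sum_add_distrib]
    exact Finset.sum_congr rfl (fun W _ => by ring)
  have eXJ : XJ = K1 + K12 := by
    rw [hXJ_def, hK1_def, hK12_def, ← Finset.sum_add_distrib]
    exact Finset.sum_congr rfl (fun W _ => by ring)
  have eXU : XU = U1 + XYU := by
    rw [hXU_def, hU1_def, hXYU_def, ← Finset.sum_add_distrib]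
    exact Finset.sum_congr rfl (fun W _ => by ring)
  have eXM : XM = b1 + XYM := by
    rw [hXM_def, hb1_def, hXYM_def, ← Finset.sum_add_distrib]
    exact Finset.sum_congr rfl (fun W _ => by ring)
  have eYJ : YJ = K2 + K12 := by
    rw [hYJ_def, hK2_def, hK12_def, ← Finset.sum_add_distrib]
    exact Finset.sum_congr rfl (fun W _ => by ring)
  have eYU : YU = U2 + XYU := by
    rw [hYU_def, hU2_def, hXYU_def, ← Finset.sum_add_distrib]
    exact Finset.sum_congr rfl (fun W _ => by ring)
  have eYM : YM = b2 + XYM := by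
    rw [hYM_def, hb2_def, hXYM_def, ← Finset.sum_add_distrib]
    exact Finset.sum_congr rfl (fun W _ => by ring)
  rw [eXM, eu, eXU, et] at hBBx
  rw [eYM, eu, eYU, et] at hBBy
  rw [eδ, eu, eYJ, eYU, eXU] at hDD2
  rw [eδ, eu, eXJ, eXU, eYU] at hDD2p
  rw [eδ, eu, et, eXU, eXM, eYJ, eYU, eYM] at hGM
  rw [eδ, eu, et, eXJ, eXU, eXM, eYU, eYM] at hGMp
  rw [eu, et, eXU, eXM, eYU, eYM] at hGR1
  rw [eu, et, eXU, eXM, eYU, eYM] at hHG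
  rw [eu, et, eXU, eXM, eYU, eYM] at hHGp
  rw [eδ, eXU, eXM, eYJ] at hJG
  rw [eδ, eXJ, eYU, eYM] at hJGp
  rw [eXM, eδ, eXJ, et] at hJMx
  rw [eYM, eδ, eYJ, et] at hJMy
  rw [eXU, eδ, eXJ, eu] at hJUx
  rw [eYU, eδ, eYJ, eu] at hJUy
  rw [et, eXM, eYM] at hLam
  rw [eδ, eu, eXJ, eXU, eYM] at hMcM2p
  rw [eXM, eδ, eu, eXJ, eXU, et] at hsx
  rw [eYM, eδ, eu, eYJ, eYU, et] at hsy
  have hA1b : 0 ≤ -1*U1*b+u0*b1+-1*K1*b+K0*b1+a*b1 := by linear_combination FA1b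
  have hA1b2 : 0 ≤ -1*U1*b2+u0*XYM+-1*K1*b2+K0*XYM+a*XYM := by linear_combination FA1b2
  have hA2U1 : 0 ≤ -1*U1*U2+u0*XYU+-1*K2*U1+K0*XYU+a*XYU := by linear_combination FA2U1
  have hA2b : 0 ≤ -1*U2*b+u0*b2+-1*K2*b+K0*b2+a*b2 := by linear_combination FA2b
  have hA2b1 : 0 ≤ -1*U2*b1+u0*XYM+-1*K2*b1+K0*XYM+a*XYM := by linear_combination FA2b1
  have hIMy : 0 ≤ -1*K12*b1+-1*K2*b1+K1*XYM+K0*XYM+a*XYM := by linear_combination FIMy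
  have hK1b : 0 ≤ -1*K1*b+K0*b1+a*b1 := by linear_combination FK1b
  have hU12b : 0 ≤ -1*XYU*b+u0*XYM+a*XYM := by linear_combination FU12b
  have hU2b : 0 ≤ -1*U2*b+u0*b2+a*b2 := by linear_combination FU2b
  have hU2b1 : 0 ≤ -1*U2*b1+u0*XYM+a*XYM := by linear_combination FU2b1
  rw [eδ, eu, et, eXJ, eXU, eXM, eYJ, eYU, eYM]
  exact cg_j_general a K0 K1 K2 K12 u0 U1 U2 XYU b b1 b2 XYM ha hK00 hK10 hK20 hK120 hu00 hU10 hU20 hXYU hb0 hb10 hb20 hXYM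
    (by linear_combination hA1b) (by linear_combination hA1b2) (by linear_combination hA2U1) (by linear_combination hA2b) (by linear_combination hA2b1) (by linear_combination hBBx) (by linear_combination hBBy) (by linear_combination hDD2) (by linear_combination hDD2p) (by linear_combination hGM) (by linear_combination hGMp) (by linear_combination hGR1) (by linear_combination hHG) (by linear_combination hHGp) (by linear_combination hIMy) (by linear_combination hJG) (by linear_combination hJGp) (by linear_combination hJMx) (by linear_combination hJMy) (by linear_combination hJUx) (by linear_combination hJUy) (by linear_combination hK1b) (by linear_combination hLam) (by linear_combination hMcM2p) (by linear_combination hU12b) (by linear_combination hU2b) (by linear_combination hU2b1) (by linear_combination hsx) (by linear_combination hsy)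

end JGateMain

end Summit.Ventures.PercRepro2.Coin
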